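import Summits.QuantumFields.BalabanUV.Beta.GAN24.StaircaseCurrentAntisymm
import Summits.QuantumFields.BalabanUV.Beta.GAN24.ValueHessianFirstMoment
import Summits.QuantumFields.BalabanUV.Beta.GAN24.ExchangeE2E2ChannelValue

/-!
# `BalabanUV.Beta.GAN24.StaircaseCurrentPeriodic` — binder row G-an2-4 ∕ (CONV-C), W-slot (α-0), ROW (C) AT LEVELS `j ≥ 1`: **THE STAIRCASE CURRENT HAS A BOUNDED, `Lc`-PERIODIC,
# CONTOUR-FREE PRE-IMAGE — `Σ'_s E2_{j+1}(z,s)_{bβ}·⌊s_ν∕Lc⌋χ_β(s) = Σ'_s Σ_{b′} E2_{j+1}(z,s)_{bb′}·q_{νβ}(b′,s)`,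
# `q_{νβ}(b′,s) := [b′ = ν]·Lc⁻²·σ̃_β(s) − [b′ = β]·Lc⁻¹·σ̃_ν(s)·χ_β(s)`, `σ̃_κ(s) := s_κ % Lc − (Lc−1)∕2`** (`ν ≠ β`; every `j`, every `d`, `Lc ≥ 1`; row twin for the first leg)
# (G-an2-4 CRUX TEAM (2), seat `b2b-balaban-gan24-formalise-leaf-06` = the (γ) hand, gen 53; journal INTENT I-leaf06-g53-5)

NOT IN PRINT; OUR BOOKKEEPING ([folklore] BY NAME: gen 53's `StaircaseCurrentAntisymm.tsum_E2_mul_grad_eq_zero_of_quadGrowth` (E2 kills `d(s_ν·⌊s_β∕Lc⌋)`),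
`ValueHessianFirstMoment.tsum_E2_mul_coord_eq_zero` (E2 kills `s ↦ s_β·ĉ_ν`) ∕ `E2_swap` ∕ `tsum_E2_mul_const_eq_zero'`, `ExitFaceSlotStaircase.coord_grad ∕ stair_grad ∕ abs_coord_le ∕
abs_stair_le`, D1 `tsum_E2_mul_exitFace_eq_zero′`, (W3) `summable_E2_mul_linGrowth_face`, `ExchangeE2E2ChannelValue.sum_mul_ite_leg ∕ contourSum_csawFace_eq_zero ∕ sawFace_translate ∕
abs_sawFace_le`, `ExitFaceHalfVertexSplit.abs_csawtooth_le`, leaf-04's `PeriodicKKTExchangePairing.sum_box_mul_coord`; 0 `def`, 0 cited fact, 0 `def … : Prop`, 0 sorry).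
HONEST FRAMING (cell contract, verbatim): «discharging `BetaPertH` makes Bałaban's UV stability UNCONDITIONAL — a real constructive-QFT result; it is NOT the continuum
limit and NOT the Clay problem.»  HONEST DEPENDENCY (verbatim): «continuum YM on T⁴ ⇐ BetaPertH ∧ nine spine estimates (0/9 proved); BetaPertH ⇐ (D1) ∧ (D4) ∧ CAP+tail;
G-an2-4 gates asym, D1 and NE2/3/4.»

WHY.  `ExchangeESectorStaircase` writes the E-sector EE word through the `E2_{j+1}`-images of the linear-growth profiles `⌊·_ν∕Lc⌋·χ_β ê_β`; L4′'s telescoping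
(`ExchangeE2E2ChannelValue.sum_box_E2T_mul_dressedStep_E2_apply`) wants bounded periodic profiles with zero `Lc`-block contour sums.  The trade: `Lc·⌊s_ν∕Lc⌋ = s_ν − s_ν % Lc`;
`s_ν·χ_β ê_β = d(s_ν·⌊s_β∕Lc⌋) − ⌊s_β∕Lc⌋ ê_ν` (ν ≠ β; E2 kills the gradient — quadratic growth); `Lc·⌊s_β∕Lc⌋ ê_ν = s_β ê_ν − σ_β ê_ν` and E2 kills the linear form `s_β ê_ν`
(`ValueHessianFirstMoment`); the constant offsets die against E2's rows.  ENGINE (weight 0, E-leaf06-g53-1 kit j201825 (C-half)): the dressed right half-vertex fitted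
`s·E2(λ_ν ℓ^G_β − λ_β ĉ_ν)` to 8e-16 — these are the two summands of `q_{νβ}` (`ℓ^G_β ∝ Lc·χ_β ê_β`).
* §1 `coord_eq`, `csaw_eq` (the staircase ∕ sawtooth bookkeeping), `coordStair_grad`, `abs_coordStair_le`; §2 **`tsum_E2_mul_coordFace`** (`Σ' E2_{bβ}·s_νχ_β = −Σ' E2_{bν}·⌊s_β∕Lc⌋`),
  **`tsum_E2_mul_stair`** (`Σ' E2_{bν}·⌊s_β∕Lc⌋ = −Lc⁻¹·Σ' E2_{bν}·σ̃_β`); §3 **`stairFace_eq_periodic`** (the statement in the title) and **`stairFace_eq_periodic_fst`** (first leg);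
  §4 `qProfile_translate`, `abs_qProfile_le`, `contourSum_csaw_eq_zero`, **`contourSum_qProfile_eq_zero`** — the pre-image is admissible for L4′.
Asserts NO value of Bałaban's tables; discharges NOTHING of (C) ∕ (C)sym ∕ (Q-L) ∕ «T2Shape» ∕ «T2Drift» ∕ (hW, hWall); NEVER «G-an2-4 closed» as (CONV-C); NOT D1, NOT `BetaPertH`,
NOT continuum, NOT Clay.  2026-08-23; no existing file touched.
v1.1 (leaf-06 gen 56, 2026-08-24): `import …ExchangeE2E2ChannelValue` ADDED — v1 opened that namespace (`sum_mul_ite_leg`, `contourSum_csawFace_eq_zero`, `sawFace_translate`, `abs_sawFace_le`) without importing it (masked by the concat certificates; it would have bounced `elab.error` at filing). No other byte changed.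
-/

noncomputable section

open Finset
open scoped BigOperators
open Literature.MathematicalPhysics.QuantumFieldTheory
open Literature.MathematicalPhysics.QuantumFieldTheory.Balaban1983to89
open Literature.MathematicalPhysics.QuantumFieldTheory.Balaban1983to89.Beta
open B12Sec2to5 (l1 l1_nonneg abs_coord_le_l1)
open ExpKernelCalculus (Site MKer)
open AffineAveraging (Form1 box toSite unitVec contourSum)
open OneStepResolventKernel (Fib)
open BalabanStepJetsSucc (E2)
open Summit.QuantumFields.BalabanUV.Beta.AxialDressingRooted (one_le_of_neZero)
open Summit.QuantumFields.BalabanUV.Beta.GAN24.ValueHessianLinearGauge (tsum_E2_mul_exitFace_eq_zero')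
open Summit.QuantumFields.BalabanUV.Beta.GAN24.PeriodicKKTExchangePairing (sum_box_mul_coord)
open Summit.QuantumFields.BalabanUV.Beta.GAN24.ExitFaceHalfVertexSplit (summable_E2_mul_linGrowth_face abs_csawtooth_le)
open Summit.QuantumFields.BalabanUV.Beta.GAN24.ExchangeE2E2ChannelValue (sum_mul_ite_leg contourSum_csawFace_eq_zero sawFace_translate abs_sawFace_le)
open Summit.QuantumFields.BalabanUV.Beta.GAN24.ExitFaceSlotStaircase (coord_grad stair_grad abs_coord_le abs_stair_le)
open Summit.QuantumFields.BalabanUV.Beta.GAN24.StaircaseCurrentAntisymm (tsum_E2_mul_grad_eq_zero_of_quadGrowth)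
open Summit.QuantumFields.BalabanUV.Beta.GAN24.ValueHessianFirstMoment (summable_E2_mul_linGrowth tsum_E2_mul_coord_eq_zero tsum_E2_mul_const_eq_zero' E2_swap)

namespace Summit.QuantumFields.BalabanUV.Beta.GAN24.StaircaseCurrentPeriodic

variable {d : ℕ} {Lc : ℕ} [NeZero Lc]

/-! ## §1 Staircase and sawtooth bookkeeping -/

omit [NeZero Lc] in
/-- [folklore] `s_ν = Lc·⌊s_ν∕Lc⌋ + s_ν % Lc` (as reals). -/
theorem coord_eq (ν : Fin (d + 1)) (s : Site (d + 1)) :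
    ((s ν : ℤ) : ℝ) = (Lc : ℝ) * (((s ν / (Lc : ℤ) : ℤ) : ℝ)) + ((s ν % (Lc : ℤ) : ℤ) : ℝ) := by
  have h : (Lc : ℤ) * (s ν / (Lc : ℤ)) + s ν % (Lc : ℤ) = s ν := Int.mul_ediv_add_emod _ _
  have h' := congrArg (Int.cast : ℤ → ℝ) h
  push_cast at h'
  linarith

/-- [folklore] Hence `⌊s_ν∕Lc⌋ = Lc⁻¹·(s_ν − σ̃_ν(s) − (Lc−1)∕2)` with the centred sawtooth `σ̃_ν(s) = s_ν % Lc − (Lc−1)∕2`. -/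
theorem stair_eq (ν : Fin (d + 1)) (s : Site (d + 1)) :
    (((s ν / (Lc : ℤ) : ℤ) : ℝ)) = (Lc : ℝ)⁻¹ * (((s ν : ℤ) : ℝ) - ((((s ν % (Lc : ℤ) : ℤ) : ℝ) - ((Lc : ℝ) - 1) / 2)) - ((Lc : ℝ) - 1) / 2) := by
  have hL0 : (Lc : ℝ) ≠ 0 := by exact_mod_cast (NeZero.ne Lc)
  have h := coord_eq (Lc := Lc) ν s
  field_simp
  linarith

omit [NeZero Lc] in
/-- [folklore] The gradient of `s ↦ s_ν·⌊s_β∕Lc⌋` (`ν ≠ β`, `1 ≤ Lc`): `[l = ν]·⌊s_β∕Lc⌋ + [l = β]·s_ν·χ_β(s)`. -/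
theorem coordStair_grad (hLc : 1 ≤ Lc) {ν β : Fin (d + 1)} (hνβ : ν ≠ β) (s : Site (d + 1)) (l : Fin (d + 1)) :
    (((s + unitVec l) ν : ℤ) : ℝ) * ((((s + unitVec l) β / (Lc : ℤ) : ℤ) : ℝ)) - ((s ν : ℤ) : ℝ) * (((s β / (Lc : ℤ) : ℤ) : ℝ)) =
      (if l = ν then (((s β / (Lc : ℤ) : ℤ) : ℝ)) else 0)
        + (if l = β then ((s ν : ℤ) : ℝ) * (if s β % (Lc : ℤ) = (Lc : ℤ) - 1 then 1 else 0) else 0) := by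
  have hν := coord_grad ν l s
  have hβ := stair_grad (d := d) hLc β l s
  have eν : (((s + unitVec l) ν : ℤ) : ℝ) = ((s ν : ℤ) : ℝ) + (if l = ν then 1 else 0) := by linarith
  have eβ : ((((s + unitVec l) β / (Lc : ℤ) : ℤ) : ℝ)) = (((s β / (Lc : ℤ) : ℤ) : ℝ)) + (if l = β then (if s β % (Lc : ℤ) = (Lc : ℤ) - 1 then 1 else 0) else 0) := by
    linarith
  rw [eν, eβ]
  by_cases hlν : l = ν
  · subst hlν
    simp only [if_true, if_neg hνβ]
    ring
  · simp only [if_neg hlν]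
    split_ifs <;> ring

omit [NeZero Lc] in
/-- [folklore] Quadratic growth of `s ↦ s_ν·⌊s_β∕Lc⌋`. -/
theorem abs_coordStair_le (ν β : Fin (d + 1)) (s : Site (d + 1)) :
    |((s ν : ℤ) : ℝ) * (((s β / (Lc : ℤ) : ℤ) : ℝ))| ≤ 0 + 1 * l1 s ^ 2 := by
  have h1 := abs_coord_le ν s
  have h2 := abs_stair_le (d := d) (Lc := Lc) β s
  rw [zero_add, one_mul] at h1 h2 ⊢
  rw [abs_mul, sq]
  exact mul_le_mul h1 h2 (abs_nonneg _) (l1_nonneg s)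

/-! ## §2 Two trades under the value Hessian -/

/-- [folklore] **`Σ'_s E2(z,s)_{bβ}·s_ν·χ_β(s) = −Σ'_s E2(z,s)_{bν}·⌊s_β∕Lc⌋`** (`ν ≠ β`): E2 kills `d(s_ν·⌊s_β∕Lc⌋)`. -/
theorem tsum_E2_mul_coordFace (j : ℕ) {ν β : Fin (d + 1)} (hνβ : ν ≠ β) (z : Site (d + 1)) (b : Fin (d + 1)) :
    ∑' s : Site (d + 1), E2 d Lc (j + 1) z s (Sum.inl b) (Sum.inl β) * (((s ν : ℤ) : ℝ) * (if s β % (Lc : ℤ) = (Lc : ℤ) - 1 then (1 : ℝ) else 0)) =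
      -∑' s : Site (d + 1), E2 d Lc (j + 1) z s (Sum.inl b) (Sum.inl ν) * (((s β / (Lc : ℤ) : ℤ) : ℝ)) := by
  have hLc : 1 ≤ Lc := one_le_of_neZero Lc
  have key := tsum_E2_mul_grad_eq_zero_of_quadGrowth (Lc := Lc) (j + 1) b z
    (φ := fun s : Site (d + 1) => ((s ν : ℤ) : ℝ) * (((s β / (Lc : ℤ) : ℤ) : ℝ))) (abs_coordStair_le ν β)
  have hpt : ∀ s : Site (d + 1), (∑ l, E2 d Lc (j + 1) z s (Sum.inl b) (Sum.inl l) *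
      ((((s + unitVec l) ν : ℤ) : ℝ) * ((((s + unitVec l) β / (Lc : ℤ) : ℤ) : ℝ)) - ((s ν : ℤ) : ℝ) * (((s β / (Lc : ℤ) : ℤ) : ℝ)))) =
      E2 d Lc (j + 1) z s (Sum.inl b) (Sum.inl ν) * (((s β / (Lc : ℤ) : ℤ) : ℝ))
        + E2 d Lc (j + 1) z s (Sum.inl b) (Sum.inl β) * (((s ν : ℤ) : ℝ) * (if s β % (Lc : ℤ) = (Lc : ℤ) - 1 then (1 : ℝ) else 0)) := by
    intro s
    simp_rw [coordStair_grad hLc hνβ s, mul_add, Finset.sum_add_distrib]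
    rw [Finset.sum_eq_single ν (fun l _ hl => by rw [if_neg hl, mul_zero]) (fun h => absurd (Finset.mem_univ ν) h),
      Finset.sum_eq_single β (fun l _ hl => by rw [if_neg hl, mul_zero]) (fun h => absurd (Finset.mem_univ β) h), if_pos rfl, if_pos rfl]
  rw [tsum_congr hpt] at key
  have h1 : Summable fun s : Site (d + 1) => E2 d Lc (j + 1) z s (Sum.inl b) (Sum.inl ν) * (((s β / (Lc : ℤ) : ℤ) : ℝ)) :=
    summable_E2_mul_linGrowth (Lc := Lc) (j + 1) z b ν (abs_stair_le β)
  have h2 := summable_E2_mul_linGrowth_face (d := d) (Lc := Lc) j (lam := fun s : Site (d + 1) => ((s ν : ℤ) : ℝ)) (abs_coord_le ν) z b β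
  rw [h1.tsum_add h2] at key
  linarith

/-- [folklore] **`Σ'_s E2(z,s)_{bν}·⌊s_β∕Lc⌋ = −Lc⁻¹·Σ'_s E2(z,s)_{bν}·σ̃_β(s)`**: `Lc·⌊s_β∕Lc⌋ = s_β − σ̃_β(s) − (Lc−1)∕2`, E2 kills the linear form (`ValueHessianFirstMoment`) and the constant. -/
theorem tsum_E2_mul_stair (j : ℕ) (ν β : Fin (d + 1)) (z : Site (d + 1)) (b : Fin (d + 1)) :
    ∑' s : Site (d + 1), E2 d Lc (j + 1) z s (Sum.inl b) (Sum.inl ν) * (((s β / (Lc : ℤ) : ℤ) : ℝ)) =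
      -(Lc : ℝ)⁻¹ * ∑' s : Site (d + 1), E2 d Lc (j + 1) z s (Sum.inl b) (Sum.inl ν) * ((((s β % (Lc : ℤ) : ℤ) : ℝ) - ((Lc : ℝ) - 1) / 2)) := by
  have hLc : 1 ≤ Lc := one_le_of_neZero Lc
  have hpt : ∀ s : Site (d + 1), E2 d Lc (j + 1) z s (Sum.inl b) (Sum.inl ν) * (((s β / (Lc : ℤ) : ℤ) : ℝ)) =
      (Lc : ℝ)⁻¹ * (E2 d Lc (j + 1) z s (Sum.inl b) (Sum.inl ν) * ((s β : ℤ) : ℝ))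
        - (Lc : ℝ)⁻¹ * (E2 d Lc (j + 1) z s (Sum.inl b) (Sum.inl ν) * ((((s β % (Lc : ℤ) : ℤ) : ℝ) - ((Lc : ℝ) - 1) / 2)))
        - (Lc : ℝ)⁻¹ * (E2 d Lc (j + 1) z s (Sum.inl b) (Sum.inl ν) * (((Lc : ℝ) - 1) / 2)) := by
    intro s
    rw [stair_eq (Lc := Lc) β s]
    ring
  have h1 : Summable fun s : Site (d + 1) => E2 d Lc (j + 1) z s (Sum.inl b) (Sum.inl ν) * ((s β : ℤ) : ℝ) :=
    summable_E2_mul_linGrowth (Lc := Lc) (j + 1) z b ν (abs_coord_le β)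
  have h2 : Summable fun s : Site (d + 1) => E2 d Lc (j + 1) z s (Sum.inl b) (Sum.inl ν) * ((((s β % (Lc : ℤ) : ℤ) : ℝ) - ((Lc : ℝ) - 1) / 2)) :=
    summable_E2_mul_linGrowth (Lc := Lc) (j + 1) z b ν (abs_csawtooth_le (d := d) hLc (((Lc : ℝ) - 1) / 2) β)
  have h3 : Summable fun s : Site (d + 1) => E2 d Lc (j + 1) z s (Sum.inl b) (Sum.inl ν) * (((Lc : ℝ) - 1) / 2) :=
    summable_E2_mul_linGrowth (Lc := Lc) (j + 1) z b ν (φ := fun _ => ((Lc : ℝ) - 1) / 2) (A := |((Lc : ℝ) - 1) / 2|) (B := 0)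
      fun _ => by rw [zero_mul, add_zero]
  rw [tsum_congr hpt, ((h1.mul_left _).sub (h2.mul_left _)).tsum_sub (h3.mul_left _), (h1.mul_left _).tsum_sub (h2.mul_left _),
    tsum_mul_left, tsum_mul_left, tsum_mul_left, tsum_E2_mul_coord_eq_zero (Lc := Lc) (j + 1) b ν β z,
    tsum_E2_mul_const_eq_zero' (Lc := Lc) (j + 1) z b ν]
  ring

/-! ## §3 The periodic pre-image of the staircase current -/

/-- [folklore] **THE STAIRCASE CURRENT AS THE VALUE-HESSIAN IMAGE OF A BOUNDED PERIODIC CONTOUR-FREE PROFILE** (`ν ≠ β`; second leg, open leg `(b, z)`):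
`Σ'_s E2_{j+1}(z,s)_{bβ}·⌊s_ν∕Lc⌋χ_β(s) = Σ'_s Σ_{b′} E2_{j+1}(z,s)_{bb′}·q_{νβ}(b′,s)`,
`q_{νβ}(b′,s) = [b′ = ν]·Lc⁻²·σ̃_β(s) + [b′ = β]·(−Lc⁻¹·σ̃_ν(s))·χ_β(s)`. -/
theorem stairFace_eq_periodic (j : ℕ) {ν β : Fin (d + 1)} (hνβ : ν ≠ β) (z : Site (d + 1)) (b : Fin (d + 1)) :
    ∑' s : Site (d + 1), E2 d Lc (j + 1) z s (Sum.inl b) (Sum.inl β) * ((((s ν / (Lc : ℤ) : ℤ) : ℝ)) * (if s β % (Lc : ℤ) = (Lc : ℤ) - 1 then (1 : ℝ) else 0)) =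
      ∑' s : Site (d + 1), ∑ b' : Fin (d + 1), E2 d Lc (j + 1) z s (Sum.inl b) (Sum.inl b') *
        ((if b' = ν then ((Lc : ℝ)⁻¹ * (Lc : ℝ)⁻¹) * ((((s β % (Lc : ℤ) : ℤ) : ℝ) - ((Lc : ℝ) - 1) / 2)) else 0)
          + (if b' = β then (-(Lc : ℝ)⁻¹ * ((((s ν % (Lc : ℤ) : ℤ) : ℝ) - ((Lc : ℝ) - 1) / 2))) * (if s β % (Lc : ℤ) = (Lc : ℤ) - 1 then (1 : ℝ) else 0) else 0)) := by
  have hLc : 1 ≤ Lc := one_le_of_neZero Lc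
  -- left: staircase = Lc⁻¹(coordinate − centred sawtooth − offset), pointwise
  have hpt : ∀ s : Site (d + 1), E2 d Lc (j + 1) z s (Sum.inl b) (Sum.inl β) * ((((s ν / (Lc : ℤ) : ℤ) : ℝ)) * (if s β % (Lc : ℤ) = (Lc : ℤ) - 1 then (1 : ℝ) else 0)) =
      (Lc : ℝ)⁻¹ * (E2 d Lc (j + 1) z s (Sum.inl b) (Sum.inl β) * (((s ν : ℤ) : ℝ) * (if s β % (Lc : ℤ) = (Lc : ℤ) - 1 then (1 : ℝ) else 0)))
        - (Lc : ℝ)⁻¹ * (E2 d Lc (j + 1) z s (Sum.inl b) (Sum.inl β) * (((((s ν % (Lc : ℤ) : ℤ) : ℝ) - ((Lc : ℝ) - 1) / 2)) * (if s β % (Lc : ℤ) = (Lc : ℤ) - 1 then (1 : ℝ) else 0)))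
        - (Lc : ℝ)⁻¹ * (E2 d Lc (j + 1) z s (Sum.inl b) (Sum.inl β) * (if s β % (Lc : ℤ) = (Lc : ℤ) - 1 then (((Lc : ℝ) - 1) / 2) else 0)) := by
    intro s
    rw [stair_eq (Lc := Lc) ν s]
    split_ifs <;> ring
  have h1 := summable_E2_mul_linGrowth_face (d := d) (Lc := Lc) j (lam := fun s : Site (d + 1) => ((s ν : ℤ) : ℝ)) (abs_coord_le ν) z b β
  have h2 := summable_E2_mul_linGrowth_face (d := d) (Lc := Lc) j (lam := fun s : Site (d + 1) => (((s ν % (Lc : ℤ) : ℤ) : ℝ) - ((Lc : ℝ) - 1) / 2))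
    (abs_csawtooth_le (d := d) hLc (((Lc : ℝ) - 1) / 2) ν) z b β
  have h3 : Summable fun s : Site (d + 1) => E2 d Lc (j + 1) z s (Sum.inl b) (Sum.inl β) * (if s β % (Lc : ℤ) = (Lc : ℤ) - 1 then (((Lc : ℝ) - 1) / 2) else 0) := by
    have h := summable_E2_mul_linGrowth_face (d := d) (Lc := Lc) j (lam := fun _ : Site (d + 1) => ((Lc : ℝ) - 1) / 2) (A := |((Lc : ℝ) - 1) / 2|) (B := 0)
      (fun _ => by rw [zero_mul, add_zero]) z b β
    refine h.congr fun s => ?_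
    split_ifs <;> simp
  rw [tsum_congr hpt, ((h1.mul_left _).sub (h2.mul_left _)).tsum_sub (h3.mul_left _), (h1.mul_left _).tsum_sub (h2.mul_left _),
    tsum_mul_left, tsum_mul_left, tsum_mul_left, tsum_E2_mul_coordFace j hνβ z b, tsum_E2_mul_stair j ν β z b,
    tsum_E2_mul_exitFace_eq_zero' (Lc := Lc) (j + 1) hLc b β z (((Lc : ℝ) - 1) / 2), mul_zero, sub_zero]
  -- right: collapse the leg sum into the two profiles and split the series
  have hR : ∀ s : Site (d + 1), (∑ b' : Fin (d + 1), E2 d Lc (j + 1) z s (Sum.inl b) (Sum.inl b') *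
      ((if b' = ν then ((Lc : ℝ)⁻¹ * (Lc : ℝ)⁻¹) * ((((s β % (Lc : ℤ) : ℤ) : ℝ) - ((Lc : ℝ) - 1) / 2)) else 0)
        + (if b' = β then (-(Lc : ℝ)⁻¹ * ((((s ν % (Lc : ℤ) : ℤ) : ℝ) - ((Lc : ℝ) - 1) / 2))) * (if s β % (Lc : ℤ) = (Lc : ℤ) - 1 then (1 : ℝ) else 0) else 0))) =
      ((Lc : ℝ)⁻¹ * (Lc : ℝ)⁻¹) * (E2 d Lc (j + 1) z s (Sum.inl b) (Sum.inl ν) * ((((s β % (Lc : ℤ) : ℤ) : ℝ) - ((Lc : ℝ) - 1) / 2)))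
        - (Lc : ℝ)⁻¹ * (E2 d Lc (j + 1) z s (Sum.inl b) (Sum.inl β) * (((((s ν % (Lc : ℤ) : ℤ) : ℝ) - ((Lc : ℝ) - 1) / 2)) * (if s β % (Lc : ℤ) = (Lc : ℤ) - 1 then (1 : ℝ) else 0))) := by
    intro s
    simp_rw [mul_add, Finset.sum_add_distrib, sum_mul_ite_leg]
    ring
  have h4 : Summable fun s : Site (d + 1) => E2 d Lc (j + 1) z s (Sum.inl b) (Sum.inl ν) * ((((s β % (Lc : ℤ) : ℤ) : ℝ) - ((Lc : ℝ) - 1) / 2)) :=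
    summable_E2_mul_linGrowth (Lc := Lc) (j + 1) z b ν (abs_csawtooth_le (d := d) hLc (((Lc : ℝ) - 1) / 2) β)
  rw [tsum_congr hR, (h4.mul_left _).tsum_sub (h2.mul_left _), tsum_mul_left, tsum_mul_left]
  ring

/-- [folklore] **… FIRST-LEG TWIN** (`μ ≠ α`; open leg `(a, x)`): `Σ'_y (⌊y_μ∕Lc⌋·χ_α(y))·E2_{j+1}(y,x)_{αa} = Σ'_y Σ_b E2_{j+1}(y,x)_{ba}·q_{μα}(b,y)` (reciprocity `E2_swap`). -/
theorem stairFace_eq_periodic_fst (j : ℕ) {μ α : Fin (d + 1)} (hμα : μ ≠ α) (x : Site (d + 1)) (a : Fin (d + 1)) :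
    ∑' y : Site (d + 1), ((((y μ / (Lc : ℤ) : ℤ) : ℝ)) * (if y α % (Lc : ℤ) = (Lc : ℤ) - 1 then (1 : ℝ) else 0)) * E2 d Lc (j + 1) y x (Sum.inl α) (Sum.inl a) =
      ∑' y : Site (d + 1), ∑ b : Fin (d + 1), E2 d Lc (j + 1) y x (Sum.inl b) (Sum.inl a) *
        ((if b = μ then ((Lc : ℝ)⁻¹ * (Lc : ℝ)⁻¹) * ((((y α % (Lc : ℤ) : ℤ) : ℝ) - ((Lc : ℝ) - 1) / 2)) else 0)
          + (if b = α then (-(Lc : ℝ)⁻¹ * ((((y μ % (Lc : ℤ) : ℤ) : ℝ) - ((Lc : ℝ) - 1) / 2))) * (if y α % (Lc : ℤ) = (Lc : ℤ) - 1 then (1 : ℝ) else 0) else 0)) := by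
  have h := stairFace_eq_periodic (Lc := Lc) j hμα x a
  have hl : ∑' y : Site (d + 1), ((((y μ / (Lc : ℤ) : ℤ) : ℝ)) * (if y α % (Lc : ℤ) = (Lc : ℤ) - 1 then (1 : ℝ) else 0)) * E2 d Lc (j + 1) y x (Sum.inl α) (Sum.inl a) =
      ∑' y : Site (d + 1), E2 d Lc (j + 1) x y (Sum.inl a) (Sum.inl α) * ((((y μ / (Lc : ℤ) : ℤ) : ℝ)) * (if y α % (Lc : ℤ) = (Lc : ℤ) - 1 then (1 : ℝ) else 0)) :=
    tsum_congr fun y => by rw [E2_swap (Lc := Lc) (j + 1) x y α a, mul_comm]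
  rw [hl, h]
  refine tsum_congr fun y => Finset.sum_congr rfl fun b _ => ?_
  rw [E2_swap (Lc := Lc) (j + 1) x y b a]

/-! ## §4 The pre-image is admissible: periodic, bounded, contour-free -/

omit [NeZero Lc] in
/-- [folklore] The profile `q_{νβ}` is `Lc`-periodic. -/
theorem qProfile_translate (ν β b' : Fin (d + 1)) (s t : Site (d + 1)) :
    ((if b' = ν then ((Lc : ℝ)⁻¹ * (Lc : ℝ)⁻¹) * (((((s + (Lc : ℤ) • t) β % (Lc : ℤ) : ℤ) : ℝ) - ((Lc : ℝ) - 1) / 2)) else 0)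
        + (if b' = β then (-(Lc : ℝ)⁻¹ * (((((s + (Lc : ℤ) • t) ν % (Lc : ℤ) : ℤ) : ℝ) - ((Lc : ℝ) - 1) / 2))) *
            (if (s + (Lc : ℤ) • t) β % (Lc : ℤ) = (Lc : ℤ) - 1 then (1 : ℝ) else 0) else 0)) =
      ((if b' = ν then ((Lc : ℝ)⁻¹ * (Lc : ℝ)⁻¹) * ((((s β % (Lc : ℤ) : ℤ) : ℝ) - ((Lc : ℝ) - 1) / 2)) else 0)
        + (if b' = β then (-(Lc : ℝ)⁻¹ * ((((s ν % (Lc : ℤ) : ℤ) : ℝ) - ((Lc : ℝ) - 1) / 2))) * (if s β % (Lc : ℤ) = (Lc : ℤ) - 1 then (1 : ℝ) else 0) else 0)) := by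
  simp only [Pi.add_apply, Pi.smul_apply, smul_eq_mul, Int.add_mul_emod_self_left]

omit [NeZero Lc] in
/-- [folklore] The profile `q_{νβ}` is bounded (`1 ≤ Lc`). -/
theorem abs_qProfile_le (hLc : 1 ≤ Lc) (ν β b' : Fin (d + 1)) (s : Site (d + 1)) :
    |((if b' = ν then ((Lc : ℝ)⁻¹ * (Lc : ℝ)⁻¹) * ((((s β % (Lc : ℤ) : ℤ) : ℝ) - ((Lc : ℝ) - 1) / 2)) else 0)
        + (if b' = β then (-(Lc : ℝ)⁻¹ * ((((s ν % (Lc : ℤ) : ℤ) : ℝ) - ((Lc : ℝ) - 1) / 2))) * (if s β % (Lc : ℤ) = (Lc : ℤ) - 1 then (1 : ℝ) else 0) else 0))| ≤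
      |(Lc : ℝ)⁻¹ * (Lc : ℝ)⁻¹| * ((Lc : ℝ) + |((Lc : ℝ) - 1) / 2|) + |-(Lc : ℝ)⁻¹| * ((Lc : ℝ) + |((Lc : ℝ) - 1) / 2|) := by
  refine (abs_add_le _ _).trans (add_le_add ?_ (abs_sawFace_le hLc _ _ ν β b' s))
  have hs := abs_csawtooth_le (d := d) hLc (((Lc : ℝ) - 1) / 2) β s
  rw [zero_mul, add_zero] at hs
  have h0 : 0 ≤ |(Lc : ℝ)⁻¹ * (Lc : ℝ)⁻¹| * ((Lc : ℝ) + |((Lc : ℝ) - 1) / 2|) := by positivity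
  split_ifs
  · rw [abs_mul]
    exact mul_le_mul_of_nonneg_left hs (abs_nonneg _)
  · rwa [abs_zero]

/-- [folklore] The centred sawtooth of `s_β` on the `ν`-bonds has zero `Lc`-block contour sums (`ν ≠ β`: along a `ν`-contour `s_β` is constant, and the base points of one
block see every residue of `s_β` equally often — `sum_box_mul_coord` + Gauss). -/
theorem contourSum_csaw_eq_zero (c : ℝ) {ν β : Fin (d + 1)} (hνβ : ν ≠ β) (κ : Fin (d + 1)) (y : Site (d + 1)) :
    contourSum Lc (fun b' (s : Site (d + 1)) => if b' = ν then c * ((((s β % (Lc : ℤ) : ℤ) : ℝ) - ((Lc : ℝ) - 1) / 2)) else 0) κ y = 0 := by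
  have hLc : 1 ≤ Lc := one_le_of_neZero Lc
  unfold AffineAveraging.contourSum
  by_cases hκ : κ = ν
  · subst hκ
    simp only [if_true]
    have eβ : ∀ (b : Fin (d + 1) → ℕ) (s : ℕ), ((Lc : ℤ) • y + toSite b + (s : ℤ) • unitVec κ) β = toSite b β + (Lc : ℤ) * y β := by
      intro b s
      simp only [Pi.add_apply, Pi.smul_apply, smul_eq_mul, AffineAveraging.unitVec, Pi.single_apply, if_neg (Ne.symm hνβ), mul_zero, add_zero]
      ring
    simp_rw [eβ, Int.add_mul_emod_self_left]
    simp only [Finset.sum_const, Finset.card_range, nsmul_eq_mul]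
    have h := sum_box_mul_coord (d := d) (N := Lc) (Ne.symm hνβ) (fun t : ℤ => c * ((((t % (Lc : ℤ) : ℤ) : ℝ)) - ((Lc : ℝ) - 1) / 2)) (fun _ : ℤ => (1 : ℝ))
    simp only [mul_one] at h
    rw [← Finset.mul_sum, h]
    have e : ∀ t ∈ Finset.range Lc, (fun t : ℤ => c * ((((t % (Lc : ℤ) : ℤ) : ℝ)) - ((Lc : ℝ) - 1) / 2)) (t : ℤ) = c * ((t : ℝ) - ((Lc : ℝ) - 1) / 2) := by
      intro t ht
      have ht' : (t : ℤ) < (Lc : ℤ) := by exact_mod_cast Finset.mem_range.1 ht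
      show c * (((((t : ℤ) % (Lc : ℤ) : ℤ) : ℝ)) - ((Lc : ℝ) - 1) / 2) = c * ((t : ℝ) - ((Lc : ℝ) - 1) / 2)
      rw [Int.emod_eq_of_lt (by positivity) ht', Int.cast_natCast]
    have hG : (∑ i ∈ Finset.range Lc, (i : ℝ)) * 2 = (Lc : ℝ) * ((Lc : ℝ) - 1) := by
      have h := congrArg (Nat.cast : ℕ → ℝ) (Finset.sum_range_id_mul_two Lc)
      push_cast [Nat.cast_sub hLc] at h
      exact h
    have hz : ∑ t ∈ Finset.range Lc, (fun t : ℤ => c * ((((t % (Lc : ℤ) : ℤ) : ℝ)) - ((Lc : ℝ) - 1) / 2)) (t : ℤ) = 0 := by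
      rw [Finset.sum_congr rfl e, ← Finset.mul_sum, Finset.sum_sub_distrib, Finset.sum_const, Finset.card_range, nsmul_eq_mul]
      have : (∑ i ∈ Finset.range Lc, (i : ℝ)) - (Lc : ℝ) * (((Lc : ℝ) - 1) / 2) = 0 := by linarith
      rw [this, mul_zero]
    rw [hz]
    simp
  · simp [hκ]

/-- [folklore] **THE PRE-IMAGE `q_{νβ}` HAS ZERO `Lc`-BLOCK CONTOUR SUMS** (`ν ≠ β`; the two summands by `contourSum_csaw_eq_zero` and `contourSum_csawFace_eq_zero`). -/
theorem contourSum_qProfile_eq_zero {ν β : Fin (d + 1)} (hνβ : ν ≠ β) (κ : Fin (d + 1)) (y : Site (d + 1)) :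
    contourSum Lc (fun b' (s : Site (d + 1)) =>
      (if b' = ν then ((Lc : ℝ)⁻¹ * (Lc : ℝ)⁻¹) * ((((s β % (Lc : ℤ) : ℤ) : ℝ) - ((Lc : ℝ) - 1) / 2)) else 0)
        + (if b' = β then (-(Lc : ℝ)⁻¹ * ((((s ν % (Lc : ℤ) : ℤ) : ℝ) - ((Lc : ℝ) - 1) / 2))) * (if s β % (Lc : ℤ) = (Lc : ℤ) - 1 then (1 : ℝ) else 0) else 0)) κ y = 0 := by
  have h1 := contourSum_csaw_eq_zero (Lc := Lc) ((Lc : ℝ)⁻¹ * (Lc : ℝ)⁻¹) hνβ κ y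
  have h2 := contourSum_csawFace_eq_zero (Lc := Lc) (d := d) (-(Lc : ℝ)⁻¹) hνβ κ y
  unfold AffineAveraging.contourSum at h1 h2 ⊢
  beta_reduce at h1 h2 ⊢
  simp only [Finset.sum_add_distrib]
  linarith

end Summit.QuantumFields.BalabanUV.Beta.GAN24.StaircaseCurrentPeriodic

end
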